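import Literature.MathematicalPhysics.QuantumFieldTheory.Balaban1983to89.Node00.Record12CarriersB12Package
import Literature.MathematicalPhysics.QuantumFieldTheory.Balaban1983to89.Node00.Record12Residuals
import Literature.MathematicalPhysics.QuantumFieldTheory.Balaban1983to89.Node00.Record13NumericsOfThm1CCMW

/-!
# NODE N09 ([Balaban1987RG1] Lemma 4 (3.53) p. 280), LOCATED — WHAT node00-def-B12's DISPLAYED BY-REFERENCE PACKAGE `B12Package Rz cB λ` CERTIFIES AT THE
# RESIDUAL §2 DATA OF RECORD `Rz := RzOfRecord F N K` (def-T `Node00/Record12Residuals` §3: the UNIT recipe `U_n(M˙(·)) ≡ 1`, `J_n(M˙(·)) ≡ 0` of (I.1.15)):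
# (A) condition (iv) (I.1.16) of the spaces of record is IDLE — it holds for every configuration, so print's (i)–(iv) ARE (i)–(iii) at the frames of record;
# (B) the package's IDENTITY fields (3.38) ∕ (3.39)+(3.37) ∕ (3.42), read at unit backgrounds, certify FLAT LETTERS ONLY — the composite (3.53) configuration
# `exp iξ(𝐊 + 𝐀₂)` has unit plaquette variables on `X̃⁻²`, `exp iξ𝐇` has unit plaquette variables on `X` and zero (1.8)-current on `□̃³` — at `RzOfRecord`, at every
# Stage-12 parameter with `HasResidualsOfRecord`, and at the V17∕V18 witness `θ₁₅ᶜᶜᴹᵂ` BY NAME (companion: `…N09B12ProvisosAtRzOfRecordJunkLocated` — the junk inhabitant)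

T. Bałaban, *Renormalization group approach to lattice gauge field theories. I*, Commun. Math. Phys. **109** (1987) 249–301 [Balaban1987RG1] (= [I]);
[15] = [Balaban1985Variational], Commun. Math. Phys. **102** (1985) 277–309.  TRACK A (YM-PLAN §2b), WIDTH SEAT `pub-ymgap-dag-n09-w4` (HUMAN RULING D-0149 ∕
director-ym №197; w4 = overflow seat of node n09: an UNLISTED located piece under W-SEAT-START-LIST v2 §n09 item 1's package currency, no overlap with items 1–3).
Key of record it serves: K1⁷ `StabilityBAtRecordR13SepCoPH` = stmt-QuantumFields-20542 (`--supports`, helper; count-neutral).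

WHY.  N09's conjunct 1 at a record is the leaf `B12LeafOfRecord Rz cB λ = B12Sec2to5.Lemma4Printed (F12OfRecord Rz cB λ) λ.consts` (node00-def g32
`Node00/CarriersB12`), reached at every Stage ≥ 11 record through node00-def-B12's knit face `b12LeafOfRecord_of_package : B12Package Rz cB λ → B12LeafOfRecord Rz cB λ`
(= lit-balaban p07's `lemma4Printed_frameOf`).  At def-T's Stage-12∕13 records and at every K0∕K1 witness of record the §2 residual datum IS `RzOfRecord F N` — the UNIT
recipe (`Stage12Params.HasResidualsOfRecord.Rz_eq`; `hasResidualsOfRecord_theta13OfThm1CCMW`; `theta13OfThm1CCMW_Rz` is `rfl`), and the four-pin engine's `h09` socket at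
the X-pinned parameter IS that leaf (dag-n05-d `Record13CarriersXPinnedH.socket09_pinX3H_iff`).  W-SEAT-START-LIST §n09 item 1 asks the width seats to INSTANTIATE the
package's by-reference fields (gauge costs [14]∕[15], identities (97) [12], (J2)∕(J3)) «at the ₁₃ objects»; this file records, as kernel theorems, what those fields CAN
say at the ₁₃ objects as they stand.  def-T SAID (`Record12Residuals` §3, located (viii)) that the unit recipe's junk direction is «ENLARGEMENT of the spaces of record»;
(A) makes that citable (condition (iv) holds for every `V`; (i)–(iv) ⇔ (i)–(iii) at both frames of record).  (B) is the SECOND effect, on the package rather than on the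
spaces: the identity fields `h338` ∕ `hJn` ∕ `h339` ∕ `h342` of p07's `JInputs` READ the frames' background functions `F.bg.Un ∕ F.bg.Jn`; at the unit recipe their
background members are `∂1(p) = 1` and `0`, so (3.38) («`U_m(M˙(V)) = V^{u}` on `X̃⁻²`», [14]∕[15] composition of minimisers) reads «`∂V(p)` is conjugate to `1`», i.e.
`∂V(p) = 1`: the composite `V = exp iξ(𝐊(𝐔, 𝐀, τ) + 𝐀₂(𝐔, 𝐀, τ, B′))` of (3.53) is FLAT on `X̃⁻²` for EVERY input of the printed domain; likewise (3.39)+(3.37) makes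
`exp iξ𝐇` flat on `X` and (3.42) makes its (1.8)-current vanish on `□̃³`.  Print's `V = U_j(□₀, exp i(τB + B′))|_X` is a `j`-level minimiser composite, not a flat
configuration: at any record carrying `RzOfRecord` a `B12Package` is available ONLY for letter families with flat composites (the companion file shows it IS available
for the junk letters `𝐊 = 𝐀₂ = 0`, so N09's conjunct 1 in package form is junk-closable there).

WHAT THIS MEANS FOR THE PLAN (located; for plan ∕ dag-lead ∕ node00-def — not this seat's to file): the START-LIST §n09 item-1 programme «instantiate the `JInputs` fields
at the ₁₃ objects» can carry print's content only AFTER 11b's located residual `Sect2.Residual.bgI` is pinned to the minimisers of record (`Node00.Uk`-backgrounds, the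
[B11] Thm-1 objects behind `critCfgOfRecord`) — with the unit recipe every identity field admits flat letters only; and a K1 skeleton that pins N09 BY NAME (the v2∕v3 device
used for N08∕N12) does not bar a hollow closure of conjunct 1 while the record's `Rz` is the unit recipe.  Nothing here touches conjunct 2 (dag-n24-c's
`B12NodeKnitRecord13SepCoPH`), the K0 stubs, or any count.

WHAT IS PROVED (kernel bookkeeping; theorems only, def-free, sorry-free, standard axioms).  §1 `bg_Un_frameX_of_eq_unit` ∕ `bg_Jn_frameX_of_eq_unit` ∕ `bg_Un_frameBox_of_eq_unit` ∕
`bg_Jn_frameBox_of_eq_unit` (faces), `csX_ξ_pos` ∕ `csBox_ξ_pos` ∕ `csX_L_pos` ∕ `csBox_L_pos`, `condIV_frameX_of_eq_unit` ∕ `condIV_frameBox_of_eq_unit` ((iv) for every `V`,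
`0 < α₀`), `satisfies_frameX_iff_of_eq_unit` ∕ `satisfies_frameBox_iff_of_eq_unit` ((i)–(iv) ⇔ (i)–(iii)), `satisfies_unitPair_frameBox_of_eq_unit`.  §2
`plaq_comp_eq_one_of_b12Package` ((3.38) ⇒ flat composite on `X̃⁻²`), `current_gaugeU_comp_eq_zero_of_b12Package` (its current half), `plaq_expI_H_eq_one_of_b12Package`
((3.39)+(3.37) ⇒ `exp iξ𝐇` flat on `X`), `current_expI_H_eq_zero_of_b12Package` ((3.42) ⇒ `J(exp iξ𝐇) = 0` on `□̃³`) — for a general `Rz` equal to the unit recipe.  §3 the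
same AT `RzOfRecord F N K` (`rzOfRecord_eq_unit`, `plaq_comp_eq_one_of_b12Package_RzOfRecord`), at a Stage-12 parameter with `HasResidualsOfRecord`
(`rz_eq_unit_of_hasResidualsOfRecord`, `plaq_comp_eq_one_of_b12Package_of_hasResidualsOfRecord`) and at `θ₁₅ᶜᶜᴹᵂ` by name (`plaq_comp_eq_one_of_b12Package_theta13OfThm1CCMW`).

HONEST FRAMING: LOCATED, count-neutral kernel bookkeeping on NODE 00's objects (`RzOfRecord`, `F12OfRecord`, `B12Package` read BY NAME, nothing re-declared); NO estimate of
Bałaban's is proved or denied; N09 NOT discharged; K0⁷ ∕ K1⁷ NOT closed; one finite four-torus programme at fixed `ε = L^{−K}` per run — conditional finite-𝕋⁴ bookkeeping;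
R4 closes rung `BalabanLadder.UV` only; NOT ℝ⁴, NOT infinite volume, NOT OS, NOT a mass gap, NOT Clay.
-/

noncomputable section

namespace Summit.QuantumFields.YangMills.BalabanUVNodes.N09B12PackageAtRzOfRecordLocated

open Literature.MathematicalPhysics.QuantumFieldTheory.Balaban1983to89
open Literature.MathematicalPhysics.QuantumFieldTheory.Balaban1983to89.Node00
open Literature.MathematicalPhysics.QuantumFieldTheory.Balaban1983to89.T4Continuum (T4Family)
open B12RegularSpaces111 (Frame Region StepConsts space space' expI grad CondIV Satisfies SatisfiesI_III plaq gaugeU)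
open B12RegularSpaces111Mono (plaq_one unitPair satisfiesI_III_unitPair)
open B12RegularSpaces111Gauge (plaq_gaugeU)
open B12Eq18Current (current)
open B12RegularSpaces111SpecialUnitary (suModel)
open B12Lemma4Models (slProj)
open scoped Matrix.Norms.L2Operator

/-! ## §1. The faces of the unit recipe at the two [B12] frames of record; condition (iv) is idle there -/

section Unit

variable {P : Params} {N M : ℕ} {Rz : Sect2.Residual P (MatA N)}

/-- **FACE**: at the unit recipe the background function `U_m(M˙(·))` of the frame of `X` of record is the unit configuration.
[cite: Balaban1987RG1, (1.15) p.262 (bookkeeping at def-T's unit recipe)] -/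
theorem bg_Un_frameX_of_eq_unit (hRz : Rz = Sect2.Residual.unit P (MatA N)) (lam : ResidB12Run P N M) (m : ℕ) (V : PBond P 0 → (MatA N)ˣ) :
    (lam.frameX Rz).bg.Un m V = 1 := by
  subst hRz; rfl

/-- **FACE**: at the unit recipe the background current `J_m(M˙(·))` of the frame of `X` of record is zero. [cite: Balaban1987RG1, (1.15) p.262 (bookkeeping)] -/
theorem bg_Jn_frameX_of_eq_unit (hRz : Rz = Sect2.Residual.unit P (MatA N)) (lam : ResidB12Run P N M) (m : ℕ) (V : PBond P 0 → (MatA N)ˣ) :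
    (lam.frameX Rz).bg.Jn m V = 0 := by
  subst hRz; rfl

/-- **FACE**: the same for the frame of `□₀ = □̃⁵` (the upper space `U′ᶜ_{k+1}(□₀, ·)`). [cite: Balaban1987RG1, (1.15) p.262, p.275 (bookkeeping)] -/
theorem bg_Un_frameBox_of_eq_unit (hRz : Rz = Sect2.Residual.unit P (MatA N)) (lam : ResidB12Run P N M) (m : ℕ) (V : PBond P 0 → (MatA N)ˣ) :
    (lam.frameBox Rz).bg.Un m V = 1 := by
  subst hRz; rfl

/-- **FACE**: the same for the background current of the frame of `□₀`. [cite: Balaban1987RG1, (1.15) p.262, p.275 (bookkeeping)] -/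
theorem bg_Jn_frameBox_of_eq_unit (hRz : Rz = Sect2.Residual.unit P (MatA N)) (lam : ResidB12Run P N M) (m : ℕ) (V : PBond P 0 → (MatA N)ˣ) :
    (lam.frameBox Rz).bg.Jn m V = 0 := by
  subst hRz; rfl

/-- `0 < ξ = L⁻ʲ` for the constants of the `j`-th space of record. [cite: Balaban1987RG1, (1.12) p.262 (bookkeeping)] -/
theorem csX_ξ_pos (lam : ResidB12Run P N M) (cB : ℝ) : 0 < (lam.csX cB).ξ :=
  pow_pos (inv_pos.mpr (Nat.cast_pos.mpr P.L_pos)) _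

/-- `0 < ξ′ = L^{−(k+1)}` for the constants of the `(k+1)`-st space of record. [cite: Balaban1987RG1, (1.12) p.262, p.275 (bookkeeping)] -/
theorem csBox_ξ_pos (lam : ResidB12Run P N M) (cB : ℝ) : 0 < (lam.csBox cB).ξ :=
  pow_pos (inv_pos.mpr (Nat.cast_pos.mpr P.L_pos)) _

/-- `0 < L` for the constants of the `j`-th space of record. [cite: Balaban1987RG1, (0.1) p.251 (bookkeeping)] -/
theorem csX_L_pos (lam : ResidB12Run P N M) (cB : ℝ) : 0 < (lam.csX cB).L := Nat.cast_pos.mpr P.L_pos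

/-- `0 < L` for the constants of the `(k+1)`-st space of record. [cite: Balaban1987RG1, (0.1) p.251 (bookkeeping)] -/
theorem csBox_L_pos (lam : ResidB12Run P N M) (cB : ℝ) : 0 < (lam.csBox cB).L := Nat.cast_pos.mpr P.L_pos

/-- **(A) CONDITION (iv) (I.1.16) IS IDLE AT THE FRAME OF `X` OF RECORD over the unit recipe**: for `0 < α₀` it holds for EVERY configuration `V`
(`|∂1 − 1| = 0 < α₀ξ²`, `|0| = 0 < α₀(Lⁿξ)²`) — def-T's located reading «enlargement of the spaces of record» as a kernel lemma.
[cite: Balaban1987RG1, (1.15)–(1.16) p.262] -/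
theorem condIV_frameX_of_eq_unit (hRz : Rz = Sect2.Residual.unit P (MatA N)) (lam : ResidB12Run P N M) (cB : ℝ) {α₀ : ℝ} (hα₀ : 0 < α₀)
    (V : PBond P 0 → (MatA N)ˣ) : CondIV (lam.frameX Rz).bg (lam.frameX Rz).X₂ (lam.csX cB) α₀ V := by
  have hξ := csX_ξ_pos lam cB
  have hL := csX_L_pos lam cB
  refine ⟨fun n _ _ p _ => ?_, fun n _ _ b _ => ?_⟩
  · rw [bg_Un_frameX_of_eq_unit hRz, plaq_one, Units.val_one, sub_self, norm_zero]
    positivity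
  · rw [bg_Jn_frameX_of_eq_unit hRz, Pi.zero_apply, norm_zero]
    positivity

/-- **(A) CONDITION (iv) IS IDLE AT THE FRAME OF `□₀` OF RECORD over the unit recipe** (every `V`, `0 < α₀`). [cite: Balaban1987RG1, (1.15)–(1.16) p.262, (3.40) p.278] -/
theorem condIV_frameBox_of_eq_unit (hRz : Rz = Sect2.Residual.unit P (MatA N)) (lam : ResidB12Run P N M) (cB : ℝ) {α₀ : ℝ} (hα₀ : 0 < α₀)
    (V : PBond P 0 → (MatA N)ˣ) : CondIV (lam.frameBox Rz).bg (lam.frameBox Rz).X₂ (lam.csBox cB) α₀ V := by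
  have hξ := csBox_ξ_pos lam cB
  have hL := csBox_L_pos lam cB
  refine ⟨fun n _ _ p _ => ?_, fun n _ _ b _ => ?_⟩
  · rw [bg_Un_frameBox_of_eq_unit hRz, plaq_one, Units.val_one, sub_self, norm_zero]
    positivity
  · rw [bg_Jn_frameBox_of_eq_unit hRz, Pi.zero_apply, norm_zero]
    positivity

/-- **(A′) AT THE FRAME OF `X` OF RECORD over the unit recipe, PRINT's FOUR CONDITIONS (i)–(iv) ARE THE THREE CONDITIONS (i)–(iii)** (`0 < α₀`; any value model).
[cite: Balaban1987RG1, (1.11)–(1.16) p.262] -/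
theorem satisfies_frameX_iff_of_eq_unit (hRz : Rz = Sect2.Residual.unit P (MatA N)) (𝓜 : B12RegularSpaces111.Model (MatA N)) (lam : ResidB12Run P N M)
    (cB : ℝ) {α₀ α₁ γ₀ : ℝ} (hα₀ : 0 < α₀) (Φ : FieldPair P 0 (MatA N)ˣ (MatA N)) :
    Satisfies 𝓜 (lam.frameX Rz) (lam.csX cB) α₀ α₁ γ₀ Φ ↔ SatisfiesI_III 𝓜 (lam.frameX Rz) (lam.csX cB) α₀ α₁ γ₀ Φ := by
  refine ⟨fun h => h.toI_III, fun ⟨hG, hg, U, A', hf, h1, h2, h3⟩ => ?_⟩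
  exact ⟨hG, hg, U, A', hf, h1, h2, h3, condIV_frameX_of_eq_unit hRz lam cB hα₀ _, condIV_frameX_of_eq_unit hRz lam cB hα₀ _⟩

/-- **(A′) AT THE FRAME OF `□₀` OF RECORD over the unit recipe, (i)–(iv) ⇔ (i)–(iii)** (`0 < α₀`; any value model). [cite: Balaban1987RG1, (1.11)–(1.16) p.262, (3.40) p.278] -/
theorem satisfies_frameBox_iff_of_eq_unit (hRz : Rz = Sect2.Residual.unit P (MatA N)) (𝓜 : B12RegularSpaces111.Model (MatA N)) (lam : ResidB12Run P N M)
    (cB : ℝ) {α₀ α₁ γ₀ : ℝ} (hα₀ : 0 < α₀) (Φ : FieldPair P 0 (MatA N)ˣ (MatA N)) :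
    Satisfies 𝓜 (lam.frameBox Rz) (lam.csBox cB) α₀ α₁ γ₀ Φ ↔ SatisfiesI_III 𝓜 (lam.frameBox Rz) (lam.csBox cB) α₀ α₁ γ₀ Φ := by
  refine ⟨fun h => h.toI_III, fun ⟨hG, hg, U, A', hf, h1, h2, h3⟩ => ?_⟩
  exact ⟨hG, hg, U, A', hf, h1, h2, h3, condIV_frameBox_of_eq_unit hRz lam cB hα₀ _, condIV_frameBox_of_eq_unit hRz lam cB hα₀ _⟩

/-- **The unit pair `(𝐔, 𝐉) = (1, 0)` satisfies (i)–(iv) of the upper space `U′ᶜ_{k+1}(□₀, α₀, α₁, γ₀)` of record** over the unit recipe (positive radii, `0 < O(1)LMB`):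
pub-balaban's `satisfiesI_III_unitPair` + (A). [cite: Balaban1987RG1, (1.11)–(1.16) p.262, (3.40) p.278] -/
theorem satisfies_unitPair_frameBox_of_eq_unit (hRz : Rz = Sect2.Residual.unit P (MatA N)) (𝓜 : B12RegularSpaces111.Model (MatA N)) (lam : ResidB12Run P N M)
    {cB : ℝ} (hcB : 0 < cB) {α₀ α₁ γ₀ : ℝ} (hα₀ : 0 < α₀) (hα₁ : 0 < α₁) (hγ₀ : 0 < γ₀) :
    Satisfies 𝓜 (lam.frameBox Rz) (lam.csBox cB) α₀ α₁ γ₀ unitPair :=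
  (satisfies_frameBox_iff_of_eq_unit hRz 𝓜 lam cB hα₀ _).2 (satisfiesI_III_unitPair _ (csBox_ξ_pos lam cB).ne' hcB hα₀ hα₁ hγ₀)

end Unit

/-! ## §2. (B) What the package's IDENTITY fields certify at the unit recipe: flat letters -/

section Package

variable {P : Params} {N M : ℕ} {Rz : Sect2.Residual P (MatA N)}

/-- **(B) (3.38) AT THE UNIT RECIPE ⇒ THE COMPOSITE (3.53) CONFIGURATION IS FLAT ON `X̃⁻²`**: for a package `B12Package Rz cB λ` at `Rz =` the unit recipe and every
input `(𝐔, 𝐀, τ, B′)` of the printed domain, `∂(exp iξ(𝐊(𝐔, 𝐀, τ) + 𝐀₂(𝐔, 𝐀, τ, B′)))(p) = 1` at every plaquette of `X̃⁻²` — the package's `h338` at `m := j` reads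
`∂(U_j(M˙(V)))(p) = ∂(V^{u})(p)` with left member `∂1(p) = 1` (`plaq_one`) and right member `u(x)·∂V(p)·u(x)⁻¹` (`plaq_gaugeU`).  Print's `V = U_j(□₀, ·)|_X` is NOT flat:
the identity field is satisfiable at the record's `Rz` by flat letter families only. [cite: Balaban1987RG1, (3.38) p.278, Lemma 4 (3.53) p.280; Balaban1985Averaging, (11) p.22] -/
theorem plaq_comp_eq_one_of_b12Package (hRz : Rz = Sect2.Residual.unit P (MatA N)) {cB : ℝ} {lam : ResidB12Run P N M} (L : B12Package Rz cB lam)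
    {Φ : FieldPair P 0 (MatA N)ˣ (MatA N)} {A : PBond P 0 → MatA N} {τ : ℝ} {B' : PBond P 0 → MatA N}
    (hΦ : Φ ∈ space (suModel N) (lam.frameBox Rz) (lam.csBox cB) ((1 + 2 * lam.consts.β) * lam.consts.α₀) ((1 + 2 * lam.consts.β) * lam.consts.α₁) lam.α₀)
    (hA : A ∈ lam.A331) (hτ0 : 0 ≤ τ) (hτ1 : τ ≤ 1) (hB' : ‖B'‖ < lam.consts.α₃) {p : Plaq P 0} (hp : p ∈ (lam.frameX Rz).X₂.plaqs) :
    plaq (fun b => expI (lam.csX cB).ξ (lam.K Φ A τ b + lam.A₂ Φ A τ B' b)) p = 1 := by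
  have h := (L.inputs Φ A τ B' hΦ hA hτ0 hτ1 hB').h338 lam.idx.j lam.idx.one_le_j le_rfl p hp
  rw [bg_Un_frameX_of_eq_unit hRz, plaq_one, plaq_gaugeU, eq_comm, mul_inv_eq_one] at h
  exact mul_eq_left.mp h

/-- **(B) (3.38), CURRENT HALF, AT THE UNIT RECIPE ⇒ the gauge-moved composite `V^{u_j ū_m⁻¹}` has ZERO (1.8)-current at scale `L^{−m}` on the bonds of `X̃⁻²`**,
`1 ≤ m ≤ j` (the package's `hJn`, left member `J_m(M˙(V)) = 0`). [cite: Balaban1987RG1, (3.38) p.278, (1.8) p.261, (1.15) p.262] -/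
theorem current_gaugeU_comp_eq_zero_of_b12Package (hRz : Rz = Sect2.Residual.unit P (MatA N)) {cB : ℝ} {lam : ResidB12Run P N M} (L : B12Package Rz cB lam)
    {Φ : FieldPair P 0 (MatA N)ˣ (MatA N)} {A : PBond P 0 → MatA N} {τ : ℝ} {B' : PBond P 0 → MatA N}
    (hΦ : Φ ∈ space (suModel N) (lam.frameBox Rz) (lam.csBox cB) ((1 + 2 * lam.consts.β) * lam.consts.α₀) ((1 + 2 * lam.consts.β) * lam.consts.α₁) lam.α₀)
    (hA : A ∈ lam.A331) (hτ0 : 0 ≤ τ) (hτ1 : τ ≤ 1) (hB' : ‖B'‖ < lam.consts.α₃)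
    {m : ℕ} (hm : 1 ≤ m) (hmj : m ≤ lam.idx.j) {b : PBond P 0} (hb : b ∈ (lam.frameX Rz).X₂.bonds) :
    current (slProj N) ((lam.csX cB).L ^ m)⁻¹
      (gaugeU ((L.inputs Φ A τ B' hΦ hA hτ0 hτ1 hB').uj * ((L.inputs Φ A τ B' hΦ hA hτ0 hτ1 hB').ubar m)⁻¹)
        (fun b => expI (lam.csX cB).ξ (lam.K Φ A τ b + lam.A₂ Φ A τ B' b))) b = 0 := by
  have h := (L.inputs Φ A τ B' hΦ hA hτ0 hτ1 hB').hJn m hm hmj b hb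
  rw [bg_Jn_frameX_of_eq_unit hRz, Pi.zero_apply] at h
  exact h.symm

/-- **(B) (3.39)+(3.37) AT THE UNIT RECIPE ⇒ `exp iξ𝐇` IS FLAT ON `X`**: the package's [15]-letter `𝐇 = 𝐇_j(□₀, Q(L⁻¹η𝐇_{k+1}))` has `∂(exp iξ𝐇)(p) = 1` at every plaquette of
`X` (its `h339` reads `∂(exp iξ𝐇)(p) = ∂((U_j(M˙(𝐔₀)))^{(v ū v_j u_j)⁻¹})(p)` with `U_j(M˙(𝐔₀)) = 1`). [cite: Balaban1987RG1, (3.37) p.277, (3.39) p.278] -/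
theorem plaq_expI_H_eq_one_of_b12Package (hRz : Rz = Sect2.Residual.unit P (MatA N)) {cB : ℝ} {lam : ResidB12Run P N M} (L : B12Package Rz cB lam)
    {Φ : FieldPair P 0 (MatA N)ˣ (MatA N)} {A : PBond P 0 → MatA N} {τ : ℝ} {B' : PBond P 0 → MatA N}
    (hΦ : Φ ∈ space (suModel N) (lam.frameBox Rz) (lam.csBox cB) ((1 + 2 * lam.consts.β) * lam.consts.α₀) ((1 + 2 * lam.consts.β) * lam.consts.α₁) lam.α₀)
    (hA : A ∈ lam.A331) (hτ0 : 0 ≤ τ) (hτ1 : τ ≤ 1) (hB' : ‖B'‖ < lam.consts.α₃) {p : Plaq P 0} (hp : p ∈ (lam.frameX Rz).X.plaqs) :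
    plaq (fun b => expI (lam.csX cB).ξ ((L.inputs Φ A τ B' hΦ hA hτ0 hτ1 hB').H b)) p = 1 := by
  have h := (L.inputs Φ A τ B' hΦ hA hτ0 hτ1 hB').h339 p hp
  rwa [bg_Un_frameBox_of_eq_unit hRz, plaq_gaugeU, plaq_one, mul_one, mul_inv_cancel] at h

/-- **(B) (3.42) AT THE UNIT RECIPE ⇒ `J(exp iξ𝐇) = 0` ON `□̃³`**: the (1.8)-current of the [15]-letter's exponential vanishes on the bonds of `Y = □̃³` (its `h342`'s
right member carries the background current `J_{k+1}(M˙(𝐔₀)) = 0`). [cite: Balaban1987RG1, (3.42) p.278, (1.8) p.261] -/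
theorem current_expI_H_eq_zero_of_b12Package (hRz : Rz = Sect2.Residual.unit P (MatA N)) {cB : ℝ} {lam : ResidB12Run P N M} (L : B12Package Rz cB lam)
    {Φ : FieldPair P 0 (MatA N)ˣ (MatA N)} {A : PBond P 0 → MatA N} {τ : ℝ} {B' : PBond P 0 → MatA N}
    (hΦ : Φ ∈ space (suModel N) (lam.frameBox Rz) (lam.csBox cB) ((1 + 2 * lam.consts.β) * lam.consts.α₀) ((1 + 2 * lam.consts.β) * lam.consts.α₁) lam.α₀)
    (hA : A ∈ lam.A331) (hτ0 : 0 ≤ τ) (hτ1 : τ ≤ 1) (hB' : ‖B'‖ < lam.consts.α₃) {b : PBond P 0} (hb : b ∈ lam.regionY.bonds) :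
    current (slProj N) (lam.csX cB).ξ (fun b => expI (lam.csX cB).ξ ((L.inputs Φ A τ B' hΦ hA hτ0 hτ1 hB').H b)) b = 0 := by
  have h := (L.inputs Φ A τ B' hΦ hA hτ0 hτ1 hB').h342 b hb
  rw [bg_Jn_frameBox_of_eq_unit hRz] at h
  rw [h, Pi.zero_apply, smul_zero, mul_zero, zero_mul]

end Package

/-! ## §3. (B) at `RzOfRecord F N K`, at a Stage-12 parameter carrying the residuals of record, and at the V17∕V18 witness `θ₁₅ᶜᶜᴹᵂ` by name -/

section Record

variable {F : T4Family} {N : ℕ}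

/-- `RzOfRecord F N K` IS the unit recipe on the `K`-th torus (`rfl`, def-T `Record12Residuals` §3). [cite: Balaban1987RG1, (1.15) p.262 (bookkeeping)] -/
theorem rzOfRecord_eq_unit (K : ℕ) : RzOfRecord F N K = Sect2.Residual.unit (F.P K) (MatA N) := rfl

/-- At a Stage-12 parameter carrying the residuals of record, `θ.Rz K` is the unit recipe. [cite: Balaban1987RG1, (1.15) p.262 (bookkeeping)] -/
theorem rz_eq_unit_of_hasResidualsOfRecord [NeZero N] {θ : Stage12Params F N} (h : θ.HasResidualsOfRecord F N) (K : ℕ) :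
    θ.Rz K = Sect2.Residual.unit (F.P K) (MatA N) := by
  rw [h.Rz_eq]; rfl

/-- **(B) AT `RzOfRecord F N K`**: a package at the record's §2 datum forces the composite (3.53) configuration to be flat on `X̃⁻²` (every input of the printed domain).
[cite: Balaban1987RG1, (3.38) p.278, Lemma 4 (3.53) p.280] -/
theorem plaq_comp_eq_one_of_b12Package_RzOfRecord {K M : ℕ} {cB : ℝ} {lam : ResidB12Run (F.P K) N M} (L : B12Package (RzOfRecord F N K) cB lam)
    {Φ : FieldPair (F.P K) 0 (MatA N)ˣ (MatA N)} {A : PBond (F.P K) 0 → MatA N} {τ : ℝ} {B' : PBond (F.P K) 0 → MatA N}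
    (hΦ : Φ ∈ space (suModel N) (lam.frameBox (RzOfRecord F N K)) (lam.csBox cB) ((1 + 2 * lam.consts.β) * lam.consts.α₀) ((1 + 2 * lam.consts.β) * lam.consts.α₁) lam.α₀)
    (hA : A ∈ lam.A331) (hτ0 : 0 ≤ τ) (hτ1 : τ ≤ 1) (hB' : ‖B'‖ < lam.consts.α₃) {p : Plaq (F.P K) 0} (hp : p ∈ (lam.frameX (RzOfRecord F N K)).X₂.plaqs) :
    plaq (fun b => expI (lam.csX cB).ξ (lam.K Φ A τ b + lam.A₂ Φ A τ B' b)) p = 1 :=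
  plaq_comp_eq_one_of_b12Package (rzOfRecord_eq_unit K) L hΦ hA hτ0 hτ1 hB' hp

/-- **(B) AT A STAGE-12 PARAMETER CARRYING THE RESIDUALS OF RECORD** (`θ.HasResidualsOfRecord`; the [B12] frame of record `F12OfRecord₁₂ θ λ₁₂ P` is over `θ.Rz P.K`): a package for
the layer `λ₁₂ P` forces the composite (3.53) configuration to be flat on `X̃⁻²`. [cite: Balaban1987RG1, (3.38) p.278, Lemma 4 (3.53) p.280] -/
theorem plaq_comp_eq_one_of_b12Package_of_hasResidualsOfRecord [NeZero N] {θ : Stage12Params F N} (h : θ.HasResidualsOfRecord F N)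
    {lam12 : ResidB12 F N θ.τ9.M} {P : B12.RunParams} (L : B12Package (θ.Rz P.K) θ.s2.cB (lam12 P))
    {Φ : FieldPair (F.P P.K) 0 (MatA N)ˣ (MatA N)} {A : PBond (F.P P.K) 0 → MatA N} {τ : ℝ} {B' : PBond (F.P P.K) 0 → MatA N}
    (hΦ : Φ ∈ space (suModel N) ((lam12 P).frameBox (θ.Rz P.K)) ((lam12 P).csBox θ.s2.cB) ((1 + 2 * (lam12 P).consts.β) * (lam12 P).consts.α₀)
      ((1 + 2 * (lam12 P).consts.β) * (lam12 P).consts.α₁) (lam12 P).α₀)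
    (hA : A ∈ (lam12 P).A331) (hτ0 : 0 ≤ τ) (hτ1 : τ ≤ 1) (hB' : ‖B'‖ < (lam12 P).consts.α₃)
    {p : Plaq (F.P P.K) 0} (hp : p ∈ ((lam12 P).frameX (θ.Rz P.K)).X₂.plaqs) :
    plaq (fun b => expI ((lam12 P).csX θ.s2.cB).ξ ((lam12 P).K Φ A τ b + (lam12 P).A₂ Φ A τ B' b)) p = 1 :=
  plaq_comp_eq_one_of_b12Package (rz_eq_unit_of_hasResidualsOfRecord h P.K) L hΦ hA hτ0 hτ1 hB' hp

/-- **(B) AT THE V17∕V18 WITNESS `θ₁₅ᶜᶜᴹᵂ(j; γ; ε₀, ε₂₉; B₃, B₃′, a₀, a₁)` BY NAME** (its `Rz` IS `RzOfRecord`, `theta13OfThm1CCMW_Rz`; this is the §2 datum the X-pinned four-pin road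
`socket09_pinX3H_iff` puts under N09's `h09`): a package for a [B12] layer at the witness forces flat composites on `X̃⁻²`.
[cite: Balaban1987RG1, (3.38) p.278, Lemma 4 (3.53) p.280; Balaban1989LargeFieldI, (0.3) p.176 (the witness, bookkeeping)] -/
theorem plaq_comp_eq_one_of_b12Package_theta13OfThm1CCMW [NeZero N] {j : ℕ} {γ ε₀ ε₂₉ B₃ B₃' a₀ a₁ : ℝ}
    {lam12 : ResidB12 F N (theta13OfThm1CCMW F N j γ ε₀ ε₂₉ B₃ B₃' a₀ a₁).τ9.M} {P : B12.RunParams}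
    (L : B12Package ((theta13OfThm1CCMW F N j γ ε₀ ε₂₉ B₃ B₃' a₀ a₁).Rz P.K) (theta13OfThm1CCMW F N j γ ε₀ ε₂₉ B₃ B₃' a₀ a₁).s2.cB (lam12 P))
    {Φ : FieldPair (F.P P.K) 0 (MatA N)ˣ (MatA N)} {A : PBond (F.P P.K) 0 → MatA N} {τ : ℝ} {B' : PBond (F.P P.K) 0 → MatA N}
    (hΦ : Φ ∈ space (suModel N) ((lam12 P).frameBox ((theta13OfThm1CCMW F N j γ ε₀ ε₂₉ B₃ B₃' a₀ a₁).Rz P.K))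
      ((lam12 P).csBox (theta13OfThm1CCMW F N j γ ε₀ ε₂₉ B₃ B₃' a₀ a₁).s2.cB) ((1 + 2 * (lam12 P).consts.β) * (lam12 P).consts.α₀)
      ((1 + 2 * (lam12 P).consts.β) * (lam12 P).consts.α₁) (lam12 P).α₀)
    (hA : A ∈ (lam12 P).A331) (hτ0 : 0 ≤ τ) (hτ1 : τ ≤ 1) (hB' : ‖B'‖ < (lam12 P).consts.α₃)
    {p : Plaq (F.P P.K) 0} (hp : p ∈ ((lam12 P).frameX ((theta13OfThm1CCMW F N j γ ε₀ ε₂₉ B₃ B₃' a₀ a₁).Rz P.K)).X₂.plaqs) :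
    plaq (fun b => expI ((lam12 P).csX (theta13OfThm1CCMW F N j γ ε₀ ε₂₉ B₃ B₃' a₀ a₁).s2.cB).ξ ((lam12 P).K Φ A τ b + (lam12 P).A₂ Φ A τ B' b)) p = 1 :=
  plaq_comp_eq_one_of_b12Package_of_hasResidualsOfRecord (hasResidualsOfRecord_theta13OfThm1CCMW F N j γ ε₀ ε₂₉ B₃ B₃' a₀ a₁) L hΦ hA hτ0 hτ1 hB' hp

end Record

end Summit.QuantumFields.YangMills.BalabanUVNodes.N09B12PackageAtRzOfRecordLocated

end
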